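import Literature.IUT.HodgeTheaters.TemperedCoveringsCor23iiiOfSpecialFibre
import Literature.IUT.HodgeTheaters.StableCurveTemperedDataOfSpecialFibreCor25
import HarnessLib

/-!
# [IUTchI] §2 at the GENUINE 𝔛-datum in the whole-graph instance `ℍ := 𝔾`

Mochizuki, *Inter-universal Teichmüller theory I: construction of Hodge theaters*, kurims manuscript
(May 2020), §2 pp. 44–51: Prop. 2.2 p. 45, Cor. 2.3 (i)–(vi) pp. 47–48, Prop. 2.4 (iii) p. 50, Cor. 2.5
p. 51, for "`ℍ ⊆ 𝔾` a [connected] sub-semi-graph" (p. 44 l. 36) [cite: Mochizuki2012, §2 pp.44-51]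
(D-0012 claim key; the series is DISPUTED in print; nothing of it is asserted here), over Mochizuki,
*Semi-graphs of anabelioids*, Publ. RIMS **42** (2006), Ex. 3.10 pp. 43–45, §6 p. 69
[cite: MochizukiSemiAnbd2006, Ex 3.10 pp.43-45; §6 p.69].

PROOF-ONLY companion (no definition, no new named fact) of abc-iut-L5-t11's bridge
`StableCurveTemperedData.ofSpecialFibre` (`StableCurveTemperedDataOfSpecialFibre.lean`) and of the
Cor. 2.3 / Cor. 2.5 closers of abc-iut-w4-d058 / abc-iut-L5-d4 / abc-iut-L5-d5 / abc-iut-L5-t11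
(`TemperedCoveringsCor23iiiOfSpecialFibre.lean`, `StableCurveTemperedDataOfSpecialFibreCor25.lean`).

WHAT IS PROVED.  Print allows the sub-semi-graph `ℍ` to be ALL of `𝔾`.  In that instance the bridge's
bare parameters are `Π^tp_ℍ := Π^tp_𝔾` (`TpH := ⊤`), `Π̂_ℍ := Π̂_𝔾` (`HatH := ⊤`) and the Cor. 2.3 (vi)(b)
atom "the cusp meets an irreducible component of the special fibre contained in `ℍ`" is `True` for every
cusp.  Then, for ANY `StableCurveTemperedData` with `TpH = ⊤`, `HatH = ⊤` (first section, pure group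
theory): `Δ^tp_{X,ℍ} = Δ^tp_X`, `Δ̂_{X,ℍ} = Δ̂_X`, `Π^tp_{X,ℍ} = Π^tp_X`, `Π̂_{X,ℍ} = Π̂_X`; Cor. 2.3 (i),
(iv), (v) hold OUTRIGHT; the two "outer descent" atoms of the L5 certificate (`hOutTp`, `hOutHat`) hold
with `δ := 1`; Cor. 2.3 (vi) ⇔ every cusp satisfies the atom; Cor. 2.3 (ii) ⇔ `Δ^tp_X` is dense in
`Δ̂_X`; Prop. 2.2 ⇐ its single "in particular" clause `tp_in_hat` ("`Π^tp_𝔾` is commensurably terminal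
in `Π̂_𝔾`").  At the GENUINE datum `ofSpecialFibre X d S h36 … ⊤ ⊤ _ (fun _ => True)` (second section):
`Δ^tp_X ↪ Δ̂_X` has dense range for EVERY parameter choice (`ofSpecialFibre_denseRange_ιΔ`: `Δ_X` is
the closure of `Δ^temp_X` in `Π_{X_K}`, [SemiAnbd] §6 p. 69), the certificate binder `hH`
("`Π̂_ℍ =` closure of `Π^tp_ℍ`") holds by density of `π₁^temp(G^c) ↪ Π̂_𝔾`, and the whole §2 HELD block
of `Summit.ABC.IUTFork.Conditional.layer5_held_sec2` — Cor. 2.3 (i)–(vi), Cor. 2.5, Prop. 2.4 (iii) —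
follows from THREE binders only: "`Δ̂_X` is slim" (for (iii), via abc-iut-w4-d058's
`cor23iii_ofSpecialFibre_of_slim`), Prop. 2.4 (i) and Prop. 2.4 (ii) (for Cor. 2.5 / Prop. 2.4 (iii), via
abc-iut-L5-t11's closers) — `whole_graph_sec2_of_slim`.  PURPOSE: non-vacuity of the certificate's §2
PARAMETER binders `hH`, `hv`, `htp`, `hhat`, `hOutTp`, `hOutHat` AT THE GENUINE DATUM (they are
jointly satisfied, together with five of the six Cor. 2.3 conjuncts, in the instance `ℍ = 𝔾`); it does
NOT discharge anything for a general `ℍ ⊊ 𝔾` (the IUT application [IUTchII] Prop. 2.2 uses proper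
sub-semi-graphs).  Model-RELATIVE (∀ `X`, `d`, `S`); instance ≠ general case; typed ≠ discharged;
nothing here bears on [IUTchIII] Cor. 3.12.
-/

noncomputable section

namespace Literature.IUT.HodgeTheaters

open _root_.Topology
open scoped Pointwise
open Literature.AnabelianGeometry.SemiGraphs Literature.AnabelianGeometry.AbsoluteAnabelian
open Literature.AlgebraicGeometry.Frobenioids (IsSlimGroup)

/-! ### Group-theoretic preliminaries -/

section Prelim

variable {G : Type*} [Group G]

/-- `C_G(G) = G`: the full subgroup is commensurably terminal. [folklore] -/
private theorem isCommensurablyTerminal_top' : IsCommensurablyTerminal (⊤ : Subgroup G) := by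
  refine ⟨eq_top_iff.mpr fun g _ => ?_⟩
  rw [Subgroup.Commensurable.commensurator_mem_iff]
  have : ConjAct.toConjAct g • (⊤ : Subgroup G) = ⊤ :=
    eq_top_iff.mpr fun x _ => by
      rw [Subgroup.mem_pointwise_smul_iff_inv_smul_mem]
      exact Subgroup.mem_top _
  rw [this]

/-- Conjugation fixes a normal subgroup: `g • N = N` for the `MulAut.conj g`-action. [folklore] -/
private theorem conj_smul_eq_of_normal (N : Subgroup G) [hN : N.Normal] (g : G) :
    MulAut.conj g • N = N := by
  ext x
  rw [Subgroup.mem_pointwise_smul_iff_inv_smul_mem, ← map_inv, MulAut.smul_def, MulAut.conj_apply,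
    inv_inv]
  constructor
  · intro h
    have := hN.conj_mem _ h g
    simpa [mul_assoc] using this
  · intro h
    have := hN.conj_mem _ h g⁻¹
    simpa [mul_assoc] using this

/-- `(⊤ : Subgroup H).map H.subtype = H`. [folklore] -/
private theorem map_subtype_top' (H : Subgroup G) : (⊤ : Subgroup H).map H.subtype = H := by
  rw [← MonoidHom.range_eq_map, Subgroup.range_subtype]

end Prelim

namespace StableCurveTemperedData

/-! ### Any 𝔛-data with `Π^tp_ℍ = Π^tp_𝔾`, `Π̂_ℍ = Π̂_𝔾` -/

section WholeGraph

universe u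

variable (D : StableCurveTemperedData.{u}) (hT : D.graph.TpH = ⊤) (hH : D.graph.HatH = ⊤)

include hT in
/-- `ℍ = 𝔾` ⇒ `Δ^tp_{X,ℍ} = Δ^tp_X`. ([IUTchI] Cor 2.3(i) p.47) [claim: Mochizuki2012, status: disputed] -/
theorem deltaTpH_eq_top_of_graph : D.deltaTpH = ⊤ := by
  rw [deltaTpH, hT, Subgroup.comap_top]

include hH in
/-- `ℍ = 𝔾` ⇒ `Δ̂_{X,ℍ} = Δ̂_X`. ([IUTchI] Cor 2.3(i) p.47) [claim: Mochizuki2012, status: disputed] -/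
theorem deltaHatH_eq_top_of_graph : D.deltaHatH = ⊤ := by
  rw [deltaHatH, hH, Subgroup.comap_top]

include hT in
/-- `ℍ = 𝔾` ⇒ `Π^tp_{X,ℍ} = Π^tp_X` (the normaliser of the normal subgroup `Δ^tp_X`).
([IUTchI] Cor 2.3(iii) p.47) [claim: Mochizuki2012, status: disputed] -/
theorem piTpXH_eq_top_of_graph : D.piTpXH = ⊤ := by
  rw [piTpXH, D.deltaTpH_eq_top_of_graph hT, map_subtype_top' D.DeltaTp]
  exact Subgroup.normalizer_eq_top (H := D.DeltaTp)

include hH in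
/-- `ℍ = 𝔾` ⇒ `Π̂_{X,ℍ} = Π̂_X`. ([IUTchI] Cor 2.3(iii) p.47) [claim: Mochizuki2012, status: disputed] -/
theorem piHatXH_eq_top_of_graph : D.piHatXH = ⊤ := by
  rw [piHatXH, D.deltaHatH_eq_top_of_graph hH, map_subtype_top' D.DeltaHat]
  exact Subgroup.normalizer_eq_top (H := D.DeltaHat)

include hT hH in
/-- **Cor. 2.3 (i) at `ℍ = 𝔾`, outright.** ([IUTchI] Cor 2.3(i) p.47) [claim: Mochizuki2012, status: disputed] -/
theorem cor23i_of_graph_top : D.Cor23i := by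
  refine ⟨?_, ?_⟩
  · rw [D.deltaTpH_eq_top_of_graph hT]; exact isCommensurablyTerminal_top'
  · rw [D.deltaHatH_eq_top_of_graph hH]; exact isCommensurablyTerminal_top'

include hT hH in
/-- **Cor. 2.3 (iv) at `ℍ = 𝔾`, outright** (for either hypothesis (a)/(b), which is not used).
([IUTchI] Cor 2.3(iv) p.47) [claim: Mochizuki2012, status: disputed] -/
theorem cor23iv_of_graph_top : D.Cor23iv := by
  refine ⟨fun _ => ?_, fun _ => ?_⟩
  · rw [D.piTpXH_eq_top_of_graph hT]; exact isCommensurablyTerminal_top'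
  · rw [D.piHatXH_eq_top_of_graph hH]; exact isCommensurablyTerminal_top'

include hT hH in
/-- **Cor. 2.3 (v) at `ℍ = 𝔾`, outright**: `Δ̂_X ∩ Δ^tp_X = Δ^tp_X`. ([IUTchI] Cor 2.3(v) p.48) [claim: Mochizuki2012, status: disputed] -/
theorem cor23v_of_graph_top : D.Cor23v := by
  refine ⟨?_⟩
  rw [D.deltaHatH_eq_top_of_graph hH, D.deltaTpH_eq_top_of_graph hT, top_inf_eq,
    ← MonoidHom.range_eq_map]

include hT in
/-- **The tempered outer-descent atom `hOutTp` at `ℍ = 𝔾`** (certificate binder of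
`layer5_held_sec2`): every `Π^tp_X`-conjugate of `Δ^tp_{X,ℍ} = Δ^tp_X` is the `Δ^tp_X`-conjugate by
`δ := 1` (`Δ^tp_X ⊴ Π^tp_X`). ([IUTchI] Cor 2.3(i) p.47) [claim: Mochizuki2012, status: disputed] -/
theorem outerTp_of_graph_top :
    ∀ g : D.PiTp, ∃ d : D.DeltaTp, MulAut.conj g • (D.deltaTpH.map D.DeltaTp.subtype) =
      MulAut.conj (d : D.PiTp) • (D.deltaTpH.map D.DeltaTp.subtype) := by
  intro g
  refine ⟨1, ?_⟩
  rw [D.deltaTpH_eq_top_of_graph hT, map_subtype_top', OneMemClass.coe_one, map_one, one_smul]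
  exact conj_smul_eq_of_normal _ g

include hH in
/-- **The profinite outer-descent atom `hOutHat` at `ℍ = 𝔾`** (`Δ̂_X ⊴ Π̂_X`, `δ := 1`).
([IUTchI] Cor 2.3(i) p.47) [claim: Mochizuki2012, status: disputed] -/
theorem outerHat_of_graph_top :
    ∀ γ : D.PiHat, ∃ d : D.DeltaHat, MulAut.conj γ • (D.deltaHatH.map D.DeltaHat.subtype) =
      MulAut.conj (d : D.PiHat) • (D.deltaHatH.map D.DeltaHat.subtype) := by
  intro γ
  refine ⟨1, ?_⟩
  rw [D.deltaHatH_eq_top_of_graph hH, map_subtype_top', OneMemClass.coe_one, map_one, one_smul]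
  exact conj_smul_eq_of_normal _ γ

include hT hH in
/-- **Cor. 2.3 (vi) at `ℍ = 𝔾`**: both inertia clauses hold trivially (`I_x ⊆ Δ_X = 1 • Δ_{X,ℍ}`), so the
typed biconditional amounts to "every cusp meets a component of `ℍ = 𝔾`".
([IUTchI] Cor 2.3(vi) p.48) [claim: Mochizuki2012, status: disputed] -/
theorem cor23vi_iff_of_graph_top : D.Cor23vi ↔ ∀ x : D.Cusp, D.cuspMeetsH x := by
  have h1 : ∀ x : D.Cusp, ∃ e : D.DeltaTp, D.inertiaTp x ≤ MulAut.conj e • D.deltaTpH := fun x =>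
    ⟨1, by rw [map_one, one_smul]; exact le_top.trans_eq (D.deltaTpH_eq_top_of_graph hT).symm⟩
  have h2 : ∀ x : D.Cusp, ∃ e : D.DeltaHat, (D.inertiaTp x).map D.ιΔ ≤ MulAut.conj e • D.deltaHatH :=
    fun x => ⟨1, by rw [map_one, one_smul]; exact le_top.trans_eq (D.deltaHatH_eq_top_of_graph hH).symm⟩
  rw [cor23vi_iff]
  constructor
  · intro h x
    exact (h.1 x).mp (h1 x)
  · intro h
    exact ⟨fun x => iff_of_true (h1 x) (h x), fun x => iff_of_true (h2 x) (h x)⟩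

include hT hH in
/-- **Cor. 2.3 (vi) at `ℍ = 𝔾`** from the atom holding at every cusp.
([IUTchI] Cor 2.3(vi) p.48) [claim: Mochizuki2012, status: disputed] -/
theorem cor23vi_of_graph_top (hc : ∀ x : D.Cusp, D.cuspMeetsH x) : D.Cor23vi :=
  (D.cor23vi_iff_of_graph_top hT hH).mpr hc

include hT hH in
/-- **Cor. 2.3 (ii) at `ℍ = 𝔾` ⇔ density of `Δ^tp_X` in `Δ̂_X`** ("`Δ̂_X` may be identified with the
pro-`Σ̂` completion of `Δ^tp_X`", p. 47 l. 11–12). ([IUTchI] Cor 2.3(ii) p.47) [claim: Mochizuki2012, status: disputed] -/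
theorem cor23ii_iff_denseRange_of_graph_top : D.Cor23ii ↔ DenseRange D.ιΔ := by
  rw [cor23ii_iff, D.deltaTpH_eq_top_of_graph hT, D.deltaHatH_eq_top_of_graph hH,
    ← MonoidHom.range_eq_map, ← SetLike.coe_set_eq, Subgroup.topologicalClosure_coe,
    MonoidHom.coe_range, Subgroup.coe_top]
  exact (denseRange_iff_closure_range).symm

include hT hH in
/-- **Cor. 2.3 (ii) at `ℍ = 𝔾`** from the density of `Δ^tp_X` in `Δ̂_X`.
([IUTchI] Cor 2.3(ii) p.47) [claim: Mochizuki2012, status: disputed] -/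
theorem cor23ii_of_denseRange_of_graph_top (hd : DenseRange D.ιΔ) : D.Cor23ii :=
  (D.cor23ii_iff_denseRange_of_graph_top hT hH).mpr hd

include hT hH in
/-- **Prop. 2.2 at `ℍ = 𝔾` ⇐ its "in particular" clause**: with `Π^tp_ℍ = Π^tp_𝔾`, `Π̂_ℍ = Π̂_𝔾`, three
of the four typed clauses are `C_G(G) = G`, and the remaining one is "`Π^tp_𝔾` is commensurably
terminal in `Π̂_𝔾`". ([IUTchI] Prop 2.2 p.45) [claim: Mochizuki2012, status: disputed] -/
theorem prop22_of_tp_in_hat_of_graph_top (h : IsCommensurablyTerminal D.graph.ι.range) :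
    D.graph.CommensuratorsOfDecompositionSubgroups := by
  refine ⟨?_, ?_, ?_, h⟩
  · rw [hH]; exact isCommensurablyTerminal_top'
  · rw [hT, ← MonoidHom.range_eq_map]; exact h
  · rw [hT]; exact isCommensurablyTerminal_top'

include hT hH in
/-- **Prop. 2.2 at `ℍ = 𝔾` is EQUIVALENT to its "in particular" clause.**
([IUTchI] Prop 2.2 p.45) [claim: Mochizuki2012, status: disputed] -/
theorem prop22_iff_tp_in_hat_of_graph_top :
    D.graph.CommensuratorsOfDecompositionSubgroups ↔ IsCommensurablyTerminal D.graph.ι.range :=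
  ⟨fun h => h.tp_in_hat, D.prop22_of_tp_in_hat_of_graph_top hT hH⟩

include hT hH in
/-- **The certificate binder `hv` ("`Π̂_ℍ ∩ Π^tp_𝔾 = Π^tp_ℍ`", Cor. 2.3 (v) at the `𝔾`-level) at
`ℍ = 𝔾`, outright.** ([IUTchI] Cor 2.3(v) p.48) [claim: Mochizuki2012, status: disputed] -/
theorem graph_hatH_inter_range_of_graph_top :
    (D.graph.HatH : Set D.graph.Hat) ∩ Set.range D.graph.ι = D.graph.ι '' D.graph.TpH := by
  rw [hH, hT, Subgroup.coe_top, Subgroup.coe_top, Set.univ_inter, Set.image_univ]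

include hH hT in
/-- **The certificate binder `hH` ("`Π̂_ℍ` is the closure of `Π^tp_ℍ`") at `ℍ = 𝔾` ⇐ density of
`Π^tp_𝔾 ↪ Π̂_𝔾`.** ([IUTchI] §2 p.44) [claim: Mochizuki2012, status: disputed] -/
theorem graph_hatH_eq_closure_of_graph_top (hd : DenseRange D.graph.ι) :
    (D.graph.HatH : Set D.graph.Hat) = closure (D.graph.ι '' D.graph.TpH) := by
  rw [hH, hT, Subgroup.coe_top, Subgroup.coe_top, Set.image_univ, hd.closure_range]

include hT in
/-- **The certificate binder `htp` (Cor. 2.3 (vi), tempered direction at the `𝔾`-level) at `ℍ = 𝔾`,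
outright** (`t := 1`). ([IUTchI] Cor 2.3(vi) p.48) [claim: Mochizuki2012, status: disputed] -/
theorem inertia_map_le_conj_of_graph_top (x : D.Cusp) :
    ∃ t : D.graph.Tp, (D.inertiaTp x).map D.ρTp ≤ MulAut.conj t • D.graph.TpH :=
  ⟨1, by rw [map_one, one_smul, hT]; exact le_top⟩

end WholeGraph

/-! ### The genuine 𝔛-datum `ofSpecialFibre` -/

section Genuine

open OfSpecialFibre

variable {p : ℕ} [Fact p.Prime] (X : TemperedCurve p) (d : X.GroupLevelData)
  (S : SpecialFibreData (X.toTemperedArithmeticGroup d)) (h36 : S.Gc.Prop36Hypotheses)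
  (Sigma SigmaHat : Set ℕ) (hsub : Sigma ⊆ SigmaHat) (hne : Sigma.Nonempty)
  (hprime : ∀ q ∈ SigmaHat, q.Prime) (hp : p ∉ Sigma)

section AnyParameters

variable (TpH : Subgroup S.chart.G)
  (HatH : Subgroup (TemperedGraphGroupData.exists_completion_of_prop36 S.Gc h36 S.chart).choose)
  (hle : TpH.map (TemperedGraphGroupData.exists_completion_of_prop36 S.Gc h36
    S.chart).choose_spec.choose.toMonoidHom ≤ HatH)
  (cuspMeetsH : {x : X.Pt // X.IsCusp x} → Prop)

/-- **`Δ^tp_X ↪ Δ̂_X` has dense range at the genuine datum, for every parameter choice**: `Δ̂_X` of the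
datum is `Ker(Π_{X_K} → G_K) = Δ_X`, the CLOSURE of the image of `Δ^temp_X` in `Π_{X_K}`
([SemiAnbd] §6 p. 69 "the `∧` denotes profinite completion, or, equivalently, closure in `Π_{X_K}`";
`TemperedCurve.ker_augHat_eq_deltaHat`), and `Δ^tp_X` of the datum is `Δ^temp_X`.
[cite: MochizukiSemiAnbd2006, §6 p.69] -/
theorem ofSpecialFibre_denseRange_ιΔ :
    DenseRange (ofSpecialFibre X d S h36 Sigma SigmaHat hsub hne hprime hp TpH HatH hle cuspMeetsH).ιΔ := by
  intro y
  -- `y ∈ Ker(augHatGK) = Δ_X = closure (toHat '' Δ^temp_X)` in `Π_{X_K}`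
  have hy : (y : X.PiHat) ∈ closure ((X.toHat : X.PiTemp → X.PiHat) '' (X.DeltaTemp : Set X.PiTemp)) := by
    have hmem : (y : X.PiHat) ∈ X.DeltaHat := by
      rw [← ker_augHatGK_eq_deltaHat X d]; exact y.2
    have e : (X.DeltaHat : Set X.PiHat) =
        closure ((X.toHat : X.PiTemp → X.PiHat) '' (X.DeltaTemp : Set X.PiTemp)) := by
      rw [TemperedCurve.DeltaHat, Subgroup.topologicalClosure_coe, Subgroup.coe_map]
      rfl
    rw [← SetLike.mem_coe, e] at hmem
    exact hmem
  -- transport to the subtype `↥Ker(augHatGK)` along the embedding `Subtype.val`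
  rw [Topology.IsEmbedding.subtypeVal.closure_eq_preimage_closure_image, Set.mem_preimage]
  refine closure_mono ?_ hy
  rintro _ ⟨g, hg, rfl⟩
  have hg' : g ∈ X.augGK.toMonoidHom.ker := by rw [ker_augGK_eq_deltaTemp]; exact hg
  exact ⟨(ofSpecialFibre X d S h36 Sigma SigmaHat hsub hne hprime hp TpH HatH hle cuspMeetsH).ιΔ ⟨g, hg'⟩,
    ⟨⟨g, hg'⟩, rfl⟩, rfl⟩

/-- **`Π^tp_𝔾 ↪ Π̂_𝔾` has dense range at the genuine datum** (it is a profinite completion map,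
`iotaG_isProfiniteCompletion`). [cite: MochizukiSemiAnbd2006, Prop 3.6(iii) p.38] -/
theorem ofSpecialFibre_denseRange_graph_ι :
    DenseRange (ofSpecialFibre X d S h36 Sigma SigmaHat hsub hne hprime hp TpH HatH hle cuspMeetsH).graph.ι :=
  (iotaG_isProfiniteCompletion X d S h36).denseRange

end AnyParameters

/-- The parameter inequality `Π^tp_ℍ ↪ Π̂_ℍ` in the instance `ℍ = 𝔾` is `le_top`; recorded as a term so
that the datum below is written uniformly. ([IUTchI] §2 p.44) [claim: Mochizuki2012, status: disputed] -/
theorem wholeGraph_hle :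
    (⊤ : Subgroup S.chart.G).map (TemperedGraphGroupData.exists_completion_of_prop36 S.Gc h36
      S.chart).choose_spec.choose.toMonoidHom ≤ ⊤ :=
  le_top

/-- **Cor. 2.3 (ii) AS TYPED at the genuine datum with `ℍ := 𝔾`, outright** (density of `Δ^tp_X` in
`Δ̂_X`). ([IUTchI] Cor 2.3(ii) p.47) [claim: Mochizuki2012, status: disputed] -/
theorem wholeGraph_cor23ii (cuspMeetsH : {x : X.Pt // X.IsCusp x} → Prop) :
    (ofSpecialFibre X d S h36 Sigma SigmaHat hsub hne hprime hp ⊤ ⊤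
      (wholeGraph_hle X d S h36) cuspMeetsH).Cor23ii :=
  (ofSpecialFibre X d S h36 Sigma SigmaHat hsub hne hprime hp ⊤ ⊤ (wholeGraph_hle X d S h36)
      cuspMeetsH).cor23ii_of_denseRange_of_graph_top rfl rfl
    (ofSpecialFibre_denseRange_ιΔ X d S h36 Sigma SigmaHat hsub hne hprime hp ⊤ ⊤ _ cuspMeetsH)

/-- **The certificate binder `hH` at the genuine datum with `ℍ := 𝔾`, outright**: `Π̂_𝔾` is the closure
of `Π^tp_𝔾`. ([IUTchI] §2 p.44) [claim: Mochizuki2012, status: disputed] -/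
theorem wholeGraph_hatH_eq_closure (cuspMeetsH : {x : X.Pt // X.IsCusp x} → Prop) :
    ((ofSpecialFibre X d S h36 Sigma SigmaHat hsub hne hprime hp ⊤ ⊤ (wholeGraph_hle X d S h36)
        cuspMeetsH).graph.HatH :
      Set (ofSpecialFibre X d S h36 Sigma SigmaHat hsub hne hprime hp ⊤ ⊤ (wholeGraph_hle X d S h36)
        cuspMeetsH).graph.Hat) =
    closure ((ofSpecialFibre X d S h36 Sigma SigmaHat hsub hne hprime hp ⊤ ⊤ (wholeGraph_hle X d S h36)
        cuspMeetsH).graph.ι ''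
      (ofSpecialFibre X d S h36 Sigma SigmaHat hsub hne hprime hp ⊤ ⊤ (wholeGraph_hle X d S h36)
        cuspMeetsH).graph.TpH) :=
  (ofSpecialFibre X d S h36 Sigma SigmaHat hsub hne hprime hp ⊤ ⊤ (wholeGraph_hle X d S h36)
      cuspMeetsH).graph_hatH_eq_closure_of_graph_top rfl rfl
    (ofSpecialFibre_denseRange_graph_ι X d S h36 Sigma SigmaHat hsub hne hprime hp ⊤ ⊤ _ cuspMeetsH)

/-- **Cor. 2.3 (iii) AS TYPED at the genuine datum with `ℍ := 𝔾`, from "`Δ̂_X` is slim" ALONE**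
(abc-iut-w4-d058's `cor23iii_ofSpecialFibre_of_slim` with (i), (ii) and both descent atoms supplied by
this file; `Z(G_k) = 1` is discharged there). ([IUTchI] Cor 2.3(iii) p.47) [claim: Mochizuki2012, status: disputed] -/
theorem wholeGraph_cor23iii_of_slim (cuspMeetsH : {x : X.Pt // X.IsCusp x} → Prop)
    (hslim : (ofSpecialFibre X d S h36 Sigma SigmaHat hsub hne hprime hp ⊤ ⊤ (wholeGraph_hle X d S h36)
        cuspMeetsH).Cor23Hyp →
      IsSlimGroup (ofSpecialFibre X d S h36 Sigma SigmaHat hsub hne hprime hp ⊤ ⊤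
        (wholeGraph_hle X d S h36) cuspMeetsH).deltaHatH) :
    (ofSpecialFibre X d S h36 Sigma SigmaHat hsub hne hprime hp ⊤ ⊤ (wholeGraph_hle X d S h36)
      cuspMeetsH).Cor23iii :=
  cor23iii_ofSpecialFibre_of_slim X d S h36 Sigma SigmaHat hsub hne hprime hp ⊤ ⊤
    (wholeGraph_hle X d S h36) cuspMeetsH
    ((ofSpecialFibre X d S h36 Sigma SigmaHat hsub hne hprime hp ⊤ ⊤ (wholeGraph_hle X d S h36)
      cuspMeetsH).cor23i_of_graph_top rfl rfl)
    (wholeGraph_cor23ii X d S h36 Sigma SigmaHat hsub hne hprime hp cuspMeetsH) hslim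
    ((ofSpecialFibre X d S h36 Sigma SigmaHat hsub hne hprime hp ⊤ ⊤ (wholeGraph_hle X d S h36)
      cuspMeetsH).outerTp_of_graph_top rfl)
    ((ofSpecialFibre X d S h36 Sigma SigmaHat hsub hne hprime hp ⊤ ⊤ (wholeGraph_hle X d S h36)
      cuspMeetsH).outerHat_of_graph_top rfl)

/-- **The §2 HELD block of the L5 certificate in the instance `ℍ := 𝔾`** — same conjuncts as
`Summit.ABC.IUTFork.Conditional.layer5_held_sec2` (Cor. 2.3 (i)–(vi), Cor. 2.5 with its inertia part,
Prop. 2.4 (iii)) at the genuine datum `ofSpecialFibre X d S h36 … ⊤ ⊤ _ (fun _ => True)` — from THREE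
Prop binders: "`Δ̂_X` is slim" (KER-LEVEL shadow, for (iii)), Prop. 2.4 (i), Prop. 2.4 (ii) (HELD nodes,
for Cor. 2.5 / Prop. 2.4 (iii)); the parameter binders `h22`-minus-`tp_in_hat`, `hH`, `hker`, `hOutTp`,
`hOutHat`, `hv`, `htp`, `hhat` of the general block are all THEOREMS here and `tp_in_hat` is not needed.
DATA binder: a cusp `x` of `X`. ([IUTchI] §2 pp.47-51) [claim: Mochizuki2012, status: disputed] -/
theorem whole_graph_sec2_of_slim (x : {x : X.Pt // X.IsCusp x})
    (hslim : (ofSpecialFibre X d S h36 Sigma SigmaHat hsub hne hprime hp ⊤ ⊤ (wholeGraph_hle X d S h36)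
        (fun _ => True)).Cor23Hyp →
      IsSlimGroup (ofSpecialFibre X d S h36 Sigma SigmaHat hsub hne hprime hp ⊤ ⊤
        (wholeGraph_hle X d S h36) (fun _ => True)).deltaHatH)
    (h24i : (ofSpecialFibre X d S h36 Sigma SigmaHat hsub hne hprime hp ⊤ ⊤ (wholeGraph_hle X d S h36)
      (fun _ => True)).Prop24i)
    (h24ii : (ofSpecialFibre X d S h36 Sigma SigmaHat hsub hne hprime hp ⊤ ⊤ (wholeGraph_hle X d S h36)
      (fun _ => True)).Prop24ii) :
    (ofSpecialFibre X d S h36 Sigma SigmaHat hsub hne hprime hp ⊤ ⊤ (wholeGraph_hle X d S h36)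
        (fun _ => True)).Cor23i ∧
      (ofSpecialFibre X d S h36 Sigma SigmaHat hsub hne hprime hp ⊤ ⊤ (wholeGraph_hle X d S h36)
        (fun _ => True)).Cor23ii ∧
      (ofSpecialFibre X d S h36 Sigma SigmaHat hsub hne hprime hp ⊤ ⊤ (wholeGraph_hle X d S h36)
        (fun _ => True)).Cor23iii ∧
      (ofSpecialFibre X d S h36 Sigma SigmaHat hsub hne hprime hp ⊤ ⊤ (wholeGraph_hle X d S h36)
        (fun _ => True)).Cor23iv ∧
      (ofSpecialFibre X d S h36 Sigma SigmaHat hsub hne hprime hp ⊤ ⊤ (wholeGraph_hle X d S h36)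
        (fun _ => True)).Cor23v ∧
      (ofSpecialFibre X d S h36 Sigma SigmaHat hsub hne hprime hp ⊤ ⊤ (wholeGraph_hle X d S h36)
        (fun _ => True)).Cor23vi ∧
      ((ofSpecialFibre X d S h36 Sigma SigmaHat hsub hne hprime hp ⊤ ⊤ (wholeGraph_hle X d S h36)
          (fun _ => True)).Cor25Decomposition ∧
        (ofSpecialFibre X d S h36 Sigma SigmaHat hsub hne hprime hp ⊤ ⊤ (wholeGraph_hle X d S h36)
          (fun _ => True)).Cor25Inertia) ∧
      (ofSpecialFibre X d S h36 Sigma SigmaHat hsub hne hprime hp ⊤ ⊤ (wholeGraph_hle X d S h36)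
        (fun _ => True)).Prop24iii := by
  haveI : Nonempty X.Pt := ⟨x.1⟩
  haveI : Nonempty {x : X.Pt // X.IsCusp x} := ⟨x⟩
  exact ⟨(ofSpecialFibre X d S h36 Sigma SigmaHat hsub hne hprime hp ⊤ ⊤ (wholeGraph_hle X d S h36)
      (fun _ => True)).cor23i_of_graph_top rfl rfl,
    wholeGraph_cor23ii X d S h36 Sigma SigmaHat hsub hne hprime hp _,
    wholeGraph_cor23iii_of_slim X d S h36 Sigma SigmaHat hsub hne hprime hp _ hslim,
    (ofSpecialFibre X d S h36 Sigma SigmaHat hsub hne hprime hp ⊤ ⊤ (wholeGraph_hle X d S h36)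
      (fun _ => True)).cor23iv_of_graph_top rfl rfl,
    (ofSpecialFibre X d S h36 Sigma SigmaHat hsub hne hprime hp ⊤ ⊤ (wholeGraph_hle X d S h36)
      (fun _ => True)).cor23v_of_graph_top rfl rfl,
    (ofSpecialFibre X d S h36 Sigma SigmaHat hsub hne hprime hp ⊤ ⊤ (wholeGraph_hle X d S h36)
      (fun _ => True)).cor23vi_of_graph_top rfl rfl (fun _ => trivial),
    cor25_ofSpecialFibre X d S h36 Sigma SigmaHat hsub hne hprime hp ⊤ ⊤ (wholeGraph_hle X d S h36)
      (fun _ => True) h24i h24ii,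
    prop24iii_ofSpecialFibre X d S h36 Sigma SigmaHat hsub hne hprime hp ⊤ ⊤ (wholeGraph_hle X d S h36)
      (fun _ => True) x h24i⟩

/-- **Prop. 2.2 for the special-fibre 𝔾-data with `ℍ := 𝔾` ⇔ "`π₁^temp(G^c)` is commensurably terminal
in `Π̂_𝔾`"** (the certificate binder `h22` in this instance is ONE clause).
([IUTchI] Prop 2.2 p.45) [claim: Mochizuki2012, status: disputed] -/
theorem wholeGraph_prop22_iff (cuspMeetsH : {x : X.Pt // X.IsCusp x} → Prop) :
    (ofSpecialFibre X d S h36 Sigma SigmaHat hsub hne hprime hp ⊤ ⊤ (wholeGraph_hle X d S h36)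
        cuspMeetsH).graph.CommensuratorsOfDecompositionSubgroups ↔
      IsCommensurablyTerminal (iotaG X d S h36).toMonoidHom.range :=
  (ofSpecialFibre X d S h36 Sigma SigmaHat hsub hne hprime hp ⊤ ⊤ (wholeGraph_hle X d S h36)
    cuspMeetsH).prop22_iff_tp_in_hat_of_graph_top rfl rfl

end Genuine

end StableCurveTemperedData

end Literature.IUT.HodgeTheaters

end
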